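import Summits.QuantumAdvantage.AdviceFreeQNC0.AffBells27Windows
import Summits.QuantumAdvantage.AdviceFreeQNC0.AffBells27FrameGlue
import Summits.QuantumAdvantage.AdviceFreeQNC0.AffBells26TwoSurvivor
import Summits.QuantumAdvantage.AdviceFreeQNC0.AffBells26TargetFormula
import HarnessLib

/-!
# Sketch28 §28.1–§28.4 (planner qn-p1 g28, ROUND-27): the FAR SIDE of the (NP₁) dichotomy as SUB-FIBRE ISOLATION CERTIFICATES — statements
# (+ the planner's PROVED glue)

(VERBATIM copy of lines 75–295 of `HOME/qa-qnc0-p1/exp28/Sketch28.lean` (sha16 `b04adb4d7d167bef`), authored by the planner seat qn-p1 g28; landed by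
the prover seat qn-prover-3 g14 (ask P-28a, port half).  The §28.0 "verbatim carry-overs" are NOT re-declared, as the planner asked: `SubFibre`
is the landed `AffBells26.SubFibre` (`AffBells27Windows.lean`), `FrameDecomp` / `AffFrameLoss` are the landed `AffBells27.FrameDecomp` /
`AffBells27.AffFrameLoss` (`AffBells27FrameGlue.lean`, where `AffBells27.affFrameLoss : AffFrameLoss` is PROVED) — all reached through
`open AffBells26 AffBells27`; two one-line docstrings are added (lint); nothing else is changed.  §28.4b–§28.7 are the sibling file `AffBells28Assembly.lean`.)

Contents: §28.1 `act`, `fires`, `SysConst`, `AllWin`, `subFibreBridge` (PROVED); §28.2 `dPair`, `pair_identity` (PROVED), `moveCoins`, `MovesIn`,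
`surv`, `cShift`, **`Peeling`**, **`PeelingList`** (prover targets P-28a); §28.3 `readers`, `leafForm`, `offForm`, `effOff`, `classCount`,
`pairCount`, `parity_const_of_add` (PROVED), **`Leaf`** (prover target), `subFibre_mono`, `sysConst_mono` (PROVED); §28.4 `IsoWitness`,
`IsoRefutes`, `isoRefutes_of : PeelingList → Leaf → IsoRefutes` (PROVED), `isoFrac`, `IsoDense`, **`SubDoubleCount`** (prover target P-28b),
**`HIso`** (THE conjecture of the far side).  WHAT THIS IS NOT: statements; crux stmt-QuantumAdvantage-22907 untouched; separation NOT moved.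
-/

namespace Summit.QuantumAdvantage.AdviceFreeQNC0

namespace AffBells28

open Finset Literature.Computability.QuantumComplexity Literature.Computability.QuantumComplexity.RingHLF
open AffBells23 AffBells26 Fib19 AffBells27

/- §28.0 (Sketch28, verbatim carry-overs `SubFibre`, `FrameDecomp`, `AffFrameLoss`) — NOT re-declared: they are the landed
`AffBells26.SubFibre`, `AffBells27.FrameDecomp`, `AffBells27.AffFrameLoss`. -/

/-! ### §28.1 The sub-fibre system and the bridge to the game -/

variable {N : ℕ}

/-- Active rows at `x` (`kline x g = true`); constant along every sub-fibre. -/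
def act (x : Fin N → Bool) : Finset (Fin N) := univ.filter fun g => kline x g = true

/-- Number of rows of `R` whose MOD₃ test fires at `x'` under the offsets `c`: `#{g ∈ R : ⟨β_g, x'⟩ = c_g}`. -/
def fires (β : Fin N → Fin N → ZMod 3) (c : Fin N → ZMod 3) (R : Finset (Fin N)) (x' : Fin N → Bool) : ℕ :=
  (R.filter fun g => form β x' g = c g).card

/-- The XOR of the tests of `R` (offsets `c`) is CONSTANT on the sub-fibre of `(x, C)`. -/
def SysConst (β : Fin N → Fin N → ZMod 3) (c : Fin N → ZMod 3) (R : Finset (Fin N)) (x : Fin N → Bool) (C : Finset (Fin N)) : Prop :=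
  ∀ x' ∈ SubFibre x C, ∀ x'' ∈ SubFibre x C, fires β c R x' % 2 = fires β c R x'' % 2

/-- Every point of the sub-fibre wins. -/
def AllWin (β : Fin N → Fin N → ZMod 3) (c : Fin N → ZMod 3) (x : Fin N → Bool) (C₀ : Finset (Fin N)) : Prop :=
  ∀ x' ∈ SubFibre x C₀, RingHLF.Rel x' (affBell β c x')

/-- The affine bell answer bit is `[form β x g = c g]`. -/
theorem affBell_eq_true_iff (β : Fin N → Fin N → ZMod 3) (c : Fin N → ZMod 3) (x : Fin N → Bool) (g : Fin N) :
    affBell β c x g = true ↔ form β x g = c g := by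
  simp [affBell, form]

/-- On a sub-fibre the number of firing active bells is `fires`. -/
theorem activeOnes_affBell (β : Fin N → Fin N → ZMod 3) (c : Fin N → ZMod 3) {x x' : Fin N → Bool} (hk : kline x' = kline x) :
    activeOnes x' (affBell β c x') = fires β c (act x) x' := by
  unfold activeOnes fires act
  rw [filter_filter]
  congr 1
  refine filter_congr fun g _ => ?_
  rw [hk, affBell_eq_true_iff]

/-- **BRIDGE (PROVED).** If every point of the sub-fibre wins, the XOR of the ACTIVE tests is constant on it: by `targetFormula` the win
condition at `x'` is `fires (act x) x' + N + Z + pairs2 ≡ 0 (mod 2)` and `N + Z + pairs2` depends on the kernel line only. -/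
theorem subFibreBridge (hN : 3 ≤ N) (β : Fin N → Fin N → ZMod 3) (c : Fin N → ZMod 3) (x : Fin N → Bool) (C₀ : Finset (Fin N))
    (h : AllWin β c x C₀) : SysConst β c (act x) x C₀ := by
  intro x' hx' x'' hx''
  simp only [SubFibre, mem_filter, mem_univ, true_and] at hx' hx''
  have h1 := (targetFormula N hN x' hx'.1 (affBell β c x')).1 (h x' (by simp [SubFibre, hx'.1, hx'.2.1]; exact hx'.2.2))
  have h2 := (targetFormula N hN x'' hx''.1 (affBell β c x'')).1 (h x'' (by simp [SubFibre, hx''.1, hx''.2.1]; exact hx''.2.2))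
  rw [activeOnes_affBell β c hx'.2.1, hx'.2.1] at h1
  rw [activeOnes_affBell β c hx''.2.1, hx''.2.1] at h2
  omega

/-! ### §28.2 Pair moves inside the window and PEELING -/

/-- Change of `⟨β_g, ·⟩` when the coin pair `{i, j}` is flipped FROM the point `x₁`: a bit flipped `0 → 1` adds `β`, `1 → 0` subtracts it.
The zero set of `dPair` in `g` depends only on the PATTERN `(x₁ i, x₁ j)`: patterns `(0,0),(1,1)` give `±(β_gi + β_gj)` ("sum type"),
`(0,1),(1,0)` give `±(β_gi − β_gj)` ("difference type"). -/
def dPair (β : Fin N → Fin N → ZMod 3) (x₁ : Fin N → Bool) (g i j : Fin N) : ZMod 3 :=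
  (if x₁ i then -β g i else β g i) + (if x₁ j then -β g j else β g j)

/-- The three-term identity behind peeling: for `d ≠ 0`, `[u + d = c] + [u = c] + [u = c + d] ≡ 1 (mod 2)`. PROVED (`decide`). -/
theorem pair_identity : ∀ u d c : ZMod 3, d ≠ 0 →
    ((if u + d = c then 1 else 0) + (if u = c then 1 else 0) + (if u = c + d then 1 else 0) : ℕ) % 2 = 1 := by
  decide

/-- Coins used by a list of pair moves. -/
def moveCoins (L : List (Fin N × Fin N)) : Finset (Fin N) := (L.map Prod.fst ++ L.map Prod.snd).toFinset

/-- The moves are pairs of distinct coins of `C₀`, pairwise disjoint. -/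
def MovesIn (C₀ : Finset (Fin N)) (L : List (Fin N × Fin N)) : Prop :=
  (∀ p ∈ L, p.1 ∈ C₀ ∧ p.2 ∈ C₀) ∧ (L.map Prod.fst ++ L.map Prod.snd).Nodup

/-- SURVIVORS: active rows that SEE every move of `L` (flip patterns read off `x₁`). -/
def surv (β : Fin N → Fin N → ZMod 3) (x x₁ : Fin N → Bool) (L : List (Fin N × Fin N)) : Finset (Fin N) :=
  (act x).filter fun g => ∀ p ∈ L, dPair β x₁ g p.1 p.2 ≠ 0

/-- Offsets after peeling along `L`: `c_g + Σ_{moves} dPair`. -/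
def cShift (β : Fin N → Fin N → ZMod 3) (c : Fin N → ZMod 3) (x₁ : Fin N → Bool) (L : List (Fin N × Fin N)) : Fin N → ZMod 3 :=
  fun g => c g + (L.map fun p => dPair β x₁ g p.1 p.2).sum

/-- **ONE PEEL (statement; prover target P-28a(i)).** If the XOR of the tests of `R` is constant on `SubFibre x C₀` and `x₁` is a point of it,
then for coins `i ≠ j` of `C₀` the XOR of the tests of the rows of `R` SEEING the flip of `{i,j}` from `x₁`, with offsets shifted by `dPair`,
is constant on `SubFibre x₁ (C₀ ∖ {i,j})` (= the points of `SubFibre x C₀` with `x₁`'s pattern on `{i,j}`).  Proof: compare `x'` with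
`flipAt x' {i,j}` (both in `SubFibre x C₀` by `kline_flipAt_coins`); rows with `dPair = 0` cancel; `pair_identity` for the others. -/
def Peeling : Prop :=
  ∀ N : ℕ, 3 ≤ N → ∀ (β : Fin N → Fin N → ZMod 3) (c : Fin N → ZMod 3) (R : Finset (Fin N)) (x : Fin N → Bool) (C₀ : Finset (Fin N)),
    IsOdd x → C₀ ⊆ klineZeros x → SysConst β c R x C₀ → ∀ x₁ ∈ SubFibre x C₀, ∀ i ∈ C₀, ∀ j ∈ C₀, i ≠ j →
      SysConst β (fun g => c g + dPair β x₁ g i j) (R.filter fun g => dPair β x₁ g i j ≠ 0) x₁ ((C₀.erase i).erase j)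

/-- **PEELING ALONG A MOVE LIST (statement; P-28a(ii), induction on `L` over `Peeling`).** -/
def PeelingList : Prop :=
  ∀ N : ℕ, 3 ≤ N → ∀ (β : Fin N → Fin N → ZMod 3) (c : Fin N → ZMod 3) (x : Fin N → Bool) (C₀ : Finset (Fin N)),
    IsOdd x → C₀ ⊆ klineZeros x → SysConst β c (act x) x C₀ → ∀ x₁ ∈ SubFibre x C₀, ∀ L : List (Fin N × Fin N), MovesIn C₀ L →
      SysConst β (cShift β c x₁ L) (surv β x x₁ L) x₁ (C₀ \ moveCoins L)

/-! ### §28.3 The leaf: one or two isolated LOCAL `±`-twin classes on a sub-leaf -/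

/-- Rows of `R` that READ a coin of `S` (the others contribute constants on `SubFibre · S`). -/
def readers (β : Fin N → Fin N → ZMod 3) (R S : Finset (Fin N)) : Finset (Fin N) := R.filter fun g => ∃ i ∈ S, β g i ≠ 0

/-- The part of the form of row `g` on the coins `S` … -/
def leafForm (β : Fin N → Fin N → ZMod 3) (S : Finset (Fin N)) (x' : Fin N → Bool) (g : Fin N) : ZMod 3 :=
  ∑ i ∈ S, if x' i then β g i else 0

/-- … and the part OFF `S`, read at the base point `x₁` (constant on `SubFibre x₁ S`; `form β x' g = leafForm β S x' g + offForm β S x₁ g` for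
`x' ∈ SubFibre x₁ S`). -/
def offForm (β : Fin N → Fin N → ZMod 3) (S : Finset (Fin N)) (x₁ : Fin N → Bool) (g : Fin N) : ZMod 3 :=
  ∑ i ∈ univ \ S, if x₁ i then β g i else 0

/-- `h` is a LOCAL twin of `g` on the coins `S` (global `β h = β g` NOT required: rows agreeing with `±β g` on the varied coins JOIN the class,
each with its own effective offset). -/
abbrev LocTwin (β : Fin N → Fin N → ZMod 3) (S : Finset (Fin N)) (h g : Fin N) : Prop := ∀ i ∈ S, β h i = β g i

/-- `h` is a local ANTI-twin of `g` on `S`. -/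
abbrev LocAnti (β : Fin N → Fin N → ZMod 3) (S : Finset (Fin N)) (h g : Fin N) : Prop := ∀ i ∈ S, β h i = -β g i

/-- `h` belongs to the CLASS of `g` living on `Sj`: zero on the other part `So`, `±`-twin of `g` on `Sj`. -/
abbrev InClass (β : Fin N → Fin N → ZMod 3) (Sj So : Finset (Fin N)) (g h : Fin N) : Prop :=
  (∀ i ∈ So, β h i = 0) ∧ (LocTwin β Sj h g ∨ LocAnti β Sj h g)

/-- EFFECTIVE OFFSET of row `h` when the coins `S` are varied from `x₁`: (shifted) offset minus the off-`S` part of its form.  A local twin `h`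
of `g` fires at `x'` iff `leafForm S x' g = effOff h`, an anti-twin iff `leafForm S x' g = -effOff h`. -/
def effOff (β : Fin N → Fin N → ZMod 3) (c' : Fin N → ZMod 3) (x₁ : Fin N → Bool) (S : Finset (Fin N)) (h : Fin N) : ZMod 3 :=
  c' h - offForm β S x₁ h

/-- Signed count of the class of `g` on `Sj` (inside the readers of `S = Sj ∪ So` among `R`) at the value `t`:
`#{h : (twin, effOff h = t) ∨ (anti-twin, effOff h = -t)}` = the number of firing class members when `g`'s `Sj`-form equals `t`. -/
def classCount (β : Fin N → Fin N → ZMod 3) (c' : Fin N → ZMod 3) (x₁ : Fin N → Bool) (S Sj So R : Finset (Fin N)) (g : Fin N)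
    (t : ZMod 3) : ℕ :=
  ((readers β R S).filter fun h => (∀ i ∈ So, β h i = 0) ∧
      ((LocTwin β Sj h g ∧ effOff β c' x₁ S h = t) ∨ (LocAnti β Sj h g ∧ effOff β c' x₁ S h = -t))).card

/-- Firing members of the two classes at the point `x'` (as a function of the two leaf forms). -/
def pairCount (β : Fin N → Fin N → ZMod 3) (c' : Fin N → ZMod 3) (x₁ : Fin N → Bool) (S₁ S₂ R : Finset (Fin N)) (g₁ g₂ : Fin N)
    (x' : Fin N → Bool) : ℕ :=
  classCount β c' x₁ (S₁ ∪ S₂) S₁ S₂ R g₁ (leafForm β S₁ x' g₁) + classCount β c' x₁ (S₁ ∪ S₂) S₂ S₁ R g₂ (leafForm β S₂ x' g₂)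

/-- The abstract leaf computation (PROVED): if `K + f y` has constant parity on a set then so has `f y`. -/
theorem parity_const_of_add {Y : Type*} (T : Finset Y) (f : Y → ℕ) (K : ℕ)
    (hconst : ∀ y ∈ T, ∀ y' ∈ T, (K + f y) % 2 = (K + f y') % 2) : ∀ y ∈ T, ∀ y' ∈ T, f y % 2 = f y' % 2 := by
  intro y hy y' hy'
  have := hconst y hy y' hy'
  omega

/-- **TWO-CLASS LEAF (statement; P-28a(iii)).** Vary the coins `S₁ ⊔ S₂` from `x₁`.  If every row of `R` reading `S₁ ∪ S₂` is in the class of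
`g₁` on `S₁` (zero on `S₂`) or in the class of `g₂` on `S₂` (zero on `S₁`), and the XOR of the tests of `R` (offsets `c'`) is constant on
`SubFibre x₁ (S₁ ∪ S₂)`, then `pairCount` has constant parity there.  (`fires c' R x' = K + pairCount x'`, `K` = firing non-readers, whose forms
equal `offForm · x₁ ·`; a reader lies in at most one class and is a twin or an anti-twin but not both; then `parity_const_of_add`.)  The
single-class leaf is `S₂ = ∅`; the two-class version also certifies SLOPE MISMATCHES between classes on disjoint coins (e.g. single-coin
readers of two different coins), which is how block-diagonal and sparse strategies are refuted without any move. -/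
def Leaf : Prop :=
  ∀ N : ℕ, 3 ≤ N → ∀ (β : Fin N → Fin N → ZMod 3) (c' : Fin N → ZMod 3) (R : Finset (Fin N)) (x₁ : Fin N → Bool) (S₁ S₂ : Finset (Fin N)),
    Disjoint S₁ S₂ → ∀ g₁ g₂ : Fin N,
      (∀ h ∈ readers β R (S₁ ∪ S₂), InClass β S₁ S₂ g₁ h ∨ InClass β S₂ S₁ g₂ h) → SysConst β c' R x₁ (S₁ ∪ S₂) →
        ∀ x' ∈ SubFibre x₁ (S₁ ∪ S₂), ∀ x'' ∈ SubFibre x₁ (S₁ ∪ S₂),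
          pairCount β c' x₁ S₁ S₂ R g₁ g₂ x' % 2 = pairCount β c' x₁ S₁ S₂ R g₁ g₂ x'' % 2

/-- Shrinking the varied coin set shrinks the sub-fibre (PROVED) … -/
theorem subFibre_mono {x₁ : Fin N → Bool} {S C : Finset (Fin N)} (h : S ⊆ C) : SubFibre x₁ S ⊆ SubFibre x₁ C := by
  intro y hy
  simp only [SubFibre, mem_filter, mem_univ, true_and] at hy ⊢
  exact ⟨hy.1, hy.2.1, fun i hi => hy.2.2 i fun hiS => hi (h hiS)⟩

/-- … so constancy descends to it (PROVED). -/
theorem sysConst_mono (β : Fin N → Fin N → ZMod 3) (c : Fin N → ZMod 3) (R : Finset (Fin N)) {x₁ : Fin N → Bool}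
    {S C : Finset (Fin N)} (h : S ⊆ C) (hc : SysConst β c R x₁ C) : SysConst β c R x₁ S :=
  fun y hy y' hy' => hc y (subFibre_mono h hy) y' (subFibre_mono h hy')

/-! ### §28.4 Isolation witnesses, their density, and THE conjecture -/

/-- **ISOLATION WITNESS for `(β, c)` at the window `(x, C₀)`:** a point `x₁` of the sub-fibre (fixing flip patterns and off-forms), pairwise
disjoint pair moves `L` inside `C₀`, two disjoint coin sets `S₁, S₂` among the remaining coins (`S₂ = ∅` allowed), rows `g₁, g₂` such that every
SURVIVING reader of `S₁ ∪ S₂` is in the class of `g₁` on `S₁` or of `g₂` on `S₂`, and two points of `SubFibre x₁ (S₁ ∪ S₂)` with `pairCount` of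
different parity.  `c` enters only through `effOff`.  Decidable, finite. -/
def IsoWitness (β : Fin N → Fin N → ZMod 3) (c : Fin N → ZMod 3) (x : Fin N → Bool) (C₀ : Finset (Fin N)) : Prop :=
  ∃ x₁ ∈ SubFibre x C₀, ∃ L : List (Fin N × Fin N), MovesIn C₀ L ∧
    ∃ S₁ : Finset (Fin N), S₁ ⊆ C₀ \ moveCoins L ∧ ∃ S₂ : Finset (Fin N), S₂ ⊆ C₀ \ moveCoins L ∧ Disjoint S₁ S₂ ∧
      ∃ g₁ g₂ : Fin N, (∀ h ∈ readers β (surv β x x₁ L) (S₁ ∪ S₂), InClass β S₁ S₂ g₁ h ∨ InClass β S₂ S₁ g₂ h) ∧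
        ∃ x' ∈ SubFibre x₁ (S₁ ∪ S₂), ∃ x'' ∈ SubFibre x₁ (S₁ ∪ S₂),
          pairCount β (cShift β c x₁ L) x₁ S₁ S₂ (surv β x x₁ L) g₁ g₂ x' % 2 ≠
            pairCount β (cShift β c x₁ L) x₁ S₁ S₂ (surv β x x₁ L) g₁ g₂ x'' % 2

/-- **(I1) `IsoRefutes` (statement; P-28a = `PeelingList` + `Leaf` + `subFibreBridge`, see `isoRefutes_of`):** an isolation witness at
`(x, C₀)` forces a LOST point in `SubFibre x C₀` (indeed a MIXED sub-fibre). -/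
def IsoRefutes : Prop :=
  ∀ N : ℕ, 3 ≤ N → ∀ (β : Fin N → Fin N → ZMod 3) (c : Fin N → ZMod 3) (x : Fin N → Bool) (C₀ : Finset (Fin N)),
    IsOdd x → C₀ ⊆ klineZeros x → IsoWitness β c x C₀ → ∃ x' ∈ SubFibre x C₀, ¬ RingHLF.Rel x' (affBell β c x')

/-- Bookkeeping (PROVED): `IsoRefutes` from the pieces. -/
theorem isoRefutes_of (hP : PeelingList) (hL : Leaf) : IsoRefutes := by
  intro N hN β c x C₀ hodd hC₀ ⟨x₁, hx₁, L, hL', S₁, hS₁, S₂, hS₂, hdis, g₁, g₂, hcls, x', hx', x'', hx'', hne⟩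
  by_contra hcon
  simp only [not_exists, not_and, not_not] at hcon
  have hall : AllWin β c x C₀ := fun y hy => hcon y hy
  have h0 := subFibreBridge hN β c x C₀ hall
  have h1 := hP N hN β c x C₀ hodd hC₀ h0 x₁ hx₁ L hL'
  have h2 := sysConst_mono β (cShift β c x₁ L) (surv β x x₁ L) (union_subset hS₁ hS₂) h1
  exact hne (hL N hN β (cShift β c x₁ L) (surv β x x₁ L) x₁ S₁ S₂ hdis g₁ g₂ hcls h2 x' hx' x'' hx'')

open scoped Classical in
/-- Fraction of the `Z`-coin windows at `x` carrying an isolation witness (0 if `x` has fewer than `Z` coins). -/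
noncomputable def isoFrac (β : Fin N → Fin N → ZMod 3) (c : Fin N → ZMod 3) (Z : ℕ) (x : Fin N → Bool) : ℝ :=
  ((((klineZeros x).powersetCard Z).filter fun C₀ => IsoWitness β c x C₀).card : ℝ) / (((klineZeros x).powersetCard Z).card : ℝ)

/-- `(β, c)` is `(δ, Z)`-ISOLATION-DENSE: the witness fraction summed over the odd class is at least `δ·2^{N-1}`. -/
def IsoDense (δ : ℝ) (Z : ℕ) (β : Fin N → Fin N → ZMod 3) (c : Fin N → ZMod 3) : Prop :=
  δ * (2 : ℝ) ^ (N - 1) ≤ ∑ x ∈ univ.filter (fun x : Fin N → Bool => IsOdd x), isoFrac β c Z x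

/-- **(I2) SUB-FIBRE DOUBLE COUNT (statement; P-28b).** Map each witnessing `(x, C₀)` (weight `1/#{Z-windows of x}`) to a lost point
`x' ∈ SubFibre x C₀` (`IsoRefutes`); conversely `x ∈ SubFibre x' C₀` (≤ `2^Z` points) and `klineZeros x = klineZeros x'` (same weight), so a lost
`x'` receives total weight ≤ `2^Z`: `#losses ≥ δ·2^{N-1}/2^Z`. -/
def SubDoubleCount : Prop :=
  IsoRefutes → ∀ N : ℕ, 3 ≤ N → ∀ (Z : ℕ) (δ : ℝ) (β : Fin N → Fin N → ZMod 3) (c : Fin N → ZMod 3),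
    0 < δ → IsoDense δ Z β c → δ * (2 : ℝ) ^ (N - 1) / (2 : ℝ) ^ Z ≤ (2 : ℝ) ^ (N - 1) - (affWinCard β c : ℝ)

/-- **(I3) CONJECTURE `HIso` — THE ONE OPEN STATEMENT OF THE (NP₁) PLAN AFTER THIS SPLIT.** For some junta budget `δ₀ < 1/2`, frame dimension
`r₀`, own-junta width `w₀`, exponent `a` and window constant `K`: every affine strategy that is NOT `FrameDecomp δ₀ r₀ w₀` carries isolation
witnesses on at least a `N^{-a}` (weighted) fraction of the windows with `K·log₂N` coins, under its own offsets — UNLESS it already loses a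
`N^{-a}` fraction outright (ESCAPE CLAUSE, qn-lit g28 S-28L: a witness certifies a MIXED sub-fibre, so an anti-perfect or "locally evenly losing"
strategy has none; without the first disjunct the statement would silently contain an exact no-far-anti-perfect-strategy claim that the assembly
never uses).  GAME-FREE up to the escape clause (only kernel lines enter) and `c`-LIGHT (only the parities of the effective-offset counts of the
isolated class).  Mechanism, rates and obstruction analysis: file docstring and ROUND-27 §3–§4.  Why it might fail (BUDGET): every move must be SEEN by `g₀`, i.e. touch a coin `g₀` reads, so at most
`#(coins g₀ reads) − 2` moves are available to flush the non-twin leaf readers; a far family with design-like support correlations (every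
few coins jointly read by some row that also reads elsewhere — projective-plane supports are the toy case, still rate `≍ Z⁴/N`) could make the
required number of moves exceed every active row's read count on all but `N^{-ω(1)}` of the windows. -/
def HIso : Prop :=
  ∃ δ₀ : ℝ, δ₀ < 1 / 2 ∧ ∃ r₀ w₀ a K N₀ : ℕ, ∀ N ≥ N₀, ∀ (β : Fin N → Fin N → ZMod 3) (c : Fin N → ZMod 3),
    ¬ FrameDecomp δ₀ r₀ w₀ β →
      (affWinCard β c : ℝ) ≤ (1 - 1 / (N : ℝ) ^ a) * (2 : ℝ) ^ (N - 1) ∨ IsoDense ((1 : ℝ) / (N : ℝ) ^ a) (K * Nat.log 2 N) β c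

end AffBells28

end Summit.QuantumAdvantage.AdviceFreeQNC0
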